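import Mathlib.GroupTheory.PresentedGroup
import Mathlib.GroupTheory.QuotientGroup.Basic
import Mathlib.GroupTheory.Commutator.Basic
import Mathlib.Algebra.Group.Commutator
import Mathlib.Data.Fin.VecNotation
import Mathlib.Algebra.Group.Equiv.Basic
import Mathlib.Data.Fintype.EquivFin
import Mathlib.Data.Fintype.Prod
import Mathlib.Tactic.FinCases
import Mathlib.GroupTheory.Coprod.Basic
import Mathlib.Data.Fin.Tuple.Basic
import Mathlib.Logic.Equiv.Fin.Basic
import HarnessLib

/-!
# Group trisections (Abrams–Gay–Kirby)

Topic: `Literature/Topology/FourManifolds`. Definition request `defn-GroupTrisection` (route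
`SmoothPoincare4/GroupTrisection`: thesis/assembly/crux 2 and the fact Abrams–Gay–Kirby 2018,
Thm. 3). Pure group theory over Mathlib (`PresentedGroup`, `FreeGroup`, quotients).

## Content

* `surfaceGen g = Fin g × Bool` (`(i, false) = aᵢ`, `(i, true) = bᵢ`), `surfaceRelator g =
  ∏ᵢ [aᵢ, bᵢ]`, `SurfaceGroup g = ⟨a₁,b₁,…,a_g,b_g ∣ ∏[aᵢ,bᵢ]⟩ = π₁(Σ_g)` as a `PresentedGroup`.
* `IsFreeOfRank H n` — `H ≅ F_n` (some `FreeGroup (Fin n) ≃* H`).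
* `TrisectionKernels g = Fin 3 → Subgroup (SurfaceGroup g)`; `pairQuotient`, `tripleQuotient` —
  the quotients `S_g / ⟪Kᵢ ∪ Kⱼ⟫`, `S_g / ⟪K₁ ∪ K₂ ∪ K₃⟫` (normal closures), which are the pushouts
  `Hᵢ *_{S_g} Hⱼ` and the triple pushout when `Hᵢ = S_g / Kᵢ` (pushouts of *surjections* out of
  `S_g` are quotients of `S_g` by products of kernels).
* `IsGroupTrisection g k G K` — **Abrams–Gay–Kirby 2018, Def. 1**, in kernel form: the `Kᵢ` are
  normal, each `S_g / Kᵢ` is free of rank `g`, each `S_g / ⟪Kᵢ ∪ Kⱼ⟫` (`i ≠ j`) is free of rank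
  `k`, and `S_g / ⟪K₁ ∪ K₂ ∪ K₃⟫ ≅ G`. `GroupTrisection g k G` bundles kernels + this property +
  a chosen isomorphism with `G`; `GroupTrisection.ofHoms` builds one from three surjections
  `φᵢ : S_g →* Hᵢ` onto free groups of rank `g` (the printed form of Def. 1).
* `TrisectionKernels.Iso` — isomorphism of trisections: an automorphism of `S_g` carrying kernels
  to kernels (Abrams–Gay–Kirby 2018, §2; by Dehn–Nielsen–Baer every automorphism of `S_g` is
  induced by a (possibly orientation-reversing) mapping class of `Σ_g`).
* `trivialKernels 0` and `GroupTrisection.trivial` — the `(0,0)` trisection of the trivial group;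
  `s4Kernels` — the genus-`3` trisection of the trivial group coming from `S⁴`
  (kernels `⟪a₁,a₂,b₃⟫, ⟪a₁,b₂,a₃⟫, ⟪b₁,a₂,a₃⟫`), with `s4Kernels_isGroupTrisection` as a named
  fact (the freeness computations are routine but not automated here);
  `TrisectionKernels.stabilize` — `K ↦ K # K_{S⁴,3}` on `S_{g+3}` (type `(g+3, k+1)`,
  `stabilize_isGroupTrisection` named fact); `stabilizeIter`, `IsStablyTrivial`.
* `quotientEquivFreeGroupErase` — killing a set of generators of `S_g` meeting every handle
  leaves the free group on the survivors; with it the named fact is **discharged**: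
  `s4Kernels_isGroupTrisection_holds` (Abrams–Gay–Kirby 2018, §1, Fig. 1, "the standard trivial
  `(3,1)`-trisection").
* `stabQuotientEquivCoprod` — the vertex groups of the stabilised cube are free products
  `(S_g ⧸ ⟪S⟫) ∗ (S_3 ⧸ ⟪S'⟫)` (Abrams–Gay–Kirby 2018, Def. 2, connected sum); with
  `IsFreeOfRank.coprod` (`F_m ∗ F_n ≅ F_{m+n}`) and `coprodEquivOfSubsingleton` (`G ∗ 1 ≅ G`) the
  named fact `stabilize_isGroupTrisection` is **discharged**: `stabilize_isGroupTrisection_holds`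
  (Abrams–Gay–Kirby 2018, Def. 3).

## Sources

* A. Abrams, D. Gay, R. Kirby, *Group trisections and smooth 4-manifolds*, Geom. Topol. 22
  (2018), 1537–1545 (arXiv:1605.06731): §1 Def. 1 (group trisection), Def. 2 (connected sum =
  slot-wise free product), Def. 3 (stabilisation = connected sum with the standard trivial
  `(3,1)`-trisection; "the stabilization of a `(g,k)`-trisection of `G` is a
  `(g+3,k+1)`-trisection of the same group `G = G ∗ {1}`"), Thm. 3 / Thm. 5 (bijection with
  trisected 4-manifolds; stabilisation), §2.
* D. Gay, R. Kirby, *Trisecting 4-manifolds*, Geom. Topol. 20 (2016), 3097–3132, §1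
  (the genus-`3k` trisection of `S⁴`, stabilisation).

## Design choices

* **Kernel form.** A commutative cube of epimorphisms out of `S_g` is determined up to unique
  isomorphism by the three kernels `Kᵢ = ker φᵢ`; pushouts of epimorphisms `S_g ↠ Hᵢ` are the
  quotients by `⟪Kᵢ ∪ Kⱼ⟫`. This avoids bundling three types with group instances and Mathlib's
  `Monoid.PushoutI`; `ofHoms` recovers the printed formulation.
* `IsFreeOfRank H n := Nonempty (FreeGroup (Fin n) ≃* H)`; equivalently `H` admits a
  `FreeGroupBasis (Fin n)`.
* Stabilisation is defined on kernels; that it produces a `(g+3, k+1)` trisection of the same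
  group is a (routine) theorem recorded as a named fact, as is the trisection property of
  `s4Kernels`. `IsStablyTrivial K` (any genus `g`): some `n`-fold stabilisation of `K` is
  isomorphic to some `m`-fold stabilisation of `s4Kernels` of the same genus, the bookkeeping
  `3 + 3m = g + 3n` being an explicit equation used to transport (`TrisectionKernels.cast`).
* The surface relator is written `aᵢ bᵢ aᵢ⁻¹ bᵢ⁻¹` explicitly (product over `i` in increasing
  order).
-/

noncomputable section

namespace Literature.Topology.FourManifolds

open Subgroup

/-! ## The surface group -/

/-- Generators of the genus-`g` surface group: `(i, false) = aᵢ`, `(i, true) = bᵢ`. [folklore] -/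
abbrev surfaceGen (g : ℕ) : Type := Fin g × Bool

/-- The generator `aᵢ` in the free group on `surfaceGen g`. [folklore] -/
def genA {g : ℕ} (i : Fin g) : FreeGroup (surfaceGen g) := FreeGroup.of (i, false)

/-- The generator `bᵢ` in the free group on `surfaceGen g`. [folklore] -/
def genB {g : ℕ} (i : Fin g) : FreeGroup (surfaceGen g) := FreeGroup.of (i, true)

/-- The surface relator `∏_{i<g} [aᵢ, bᵢ]` (product in increasing order of `i`).
[cite: AbramsGayKirby2018, §1 (S_g)] -/
def surfaceRelator (g : ℕ) : FreeGroup (surfaceGen g) :=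
  ((List.finRange g).map fun i => genA i * genB i * (genA i)⁻¹ * (genB i)⁻¹).prod

/-- The genus-`g` **surface group** `S_g = π₁(Σ_g) = ⟨a₁,b₁,…,a_g,b_g ∣ ∏ᵢ [aᵢ,bᵢ]⟩`
(Abrams–Gay–Kirby 2018, §1). [cite: AbramsGayKirby2018, §1 (S_g)] -/
abbrev SurfaceGroup (g : ℕ) : Type := PresentedGroup ({surfaceRelator g} : Set (FreeGroup (surfaceGen g)))

/-- The image of `aᵢ` in `S_g`. [folklore] -/
def SurfaceGroup.a {g : ℕ} (i : Fin g) : SurfaceGroup g := PresentedGroup.of (i, false)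

/-- The image of `bᵢ` in `S_g`. [folklore] -/
def SurfaceGroup.b {g : ℕ} (i : Fin g) : SurfaceGroup g := PresentedGroup.of (i, true)

/-- `H` is **free of rank `n`**: `H ≅ F_n`. [folklore] -/
def IsFreeOfRank (H : Type*) [Group H] (n : ℕ) : Prop :=
  Nonempty (FreeGroup (Fin n) ≃* H)

/-- Freeness of a given rank is invariant under isomorphism. [folklore] -/
theorem IsFreeOfRank.of_mulEquiv {H H' : Type*} [Group H] [Group H'] {n : ℕ}
    (h : IsFreeOfRank H n) (e : H ≃* H') : IsFreeOfRank H' n :=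
  h.map fun f => f.trans e

/-! ## Kernel triples and their quotients -/

/-- A triple of subgroups of `S_g` (to be the kernels of a trisection). [cite: AbramsGayKirby2018, §1] -/
abbrev TrisectionKernels (g : ℕ) : Type := Fin 3 → Subgroup (SurfaceGroup g)

namespace TrisectionKernels

variable {g : ℕ} (K : TrisectionKernels g)

/-- The pairwise quotient `S_g / ⟪Kᵢ ∪ Kⱼ⟫` — the pushout `Hᵢ *_{S_g} Hⱼ` of `S_g ↠ Hᵢ = S_g/Kᵢ`
and `S_g ↠ Hⱼ` (Abrams–Gay–Kirby 2018, §1). [cite: AbramsGayKirby2018, §1 (pairwise pushouts)] -/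
abbrev pairQuotient (i j : Fin 3) : Type :=
  SurfaceGroup g ⧸ normalClosure ((K i : Set (SurfaceGroup g)) ∪ K j)

/-- The triple quotient `S_g / ⟪K₁ ∪ K₂ ∪ K₃⟫` — the pushout of the whole cube
(Abrams–Gay–Kirby 2018, §1). [cite: AbramsGayKirby2018, §1 (the triple pushout)] -/
abbrev tripleQuotient : Type :=
  SurfaceGroup g ⧸ normalClosure (⋃ i, (K i : Set (SurfaceGroup g)))

/-- **Isomorphism of kernel triples / group trisections**: an automorphism of `S_g` (equivalently,
by Dehn–Nielsen–Baer, a mapping class of `Σ_g`, possibly orientation-reversing) carrying `Kᵢ` to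
`K'ᵢ` for each `i` (Abrams–Gay–Kirby 2018, §2). [cite: AbramsGayKirby2018, §2 (equivalence of trisections)] -/
def Iso (K K' : TrisectionKernels g) : Prop :=
  ∃ α : SurfaceGroup g ≃* SurfaceGroup g, ∀ i, (K i).map α.toMonoidHom = K' i

/-- Isomorphism of kernel triples is reflexive. [folklore] -/
theorem Iso.refl (K : TrisectionKernels g) : Iso K K :=
  ⟨MulEquiv.refl _, fun i => by simp⟩

/-- Transport of kernel triples along an equality of genera. [folklore] -/
def cast {g g' : ℕ} (h : g = g') (K : TrisectionKernels g) : TrisectionKernels g' :=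
  h ▸ K

/-- Transport along `rfl` is the identity. [folklore] -/
@[simp] theorem cast_rfl (K : TrisectionKernels g) : K.cast rfl = K := rfl

end TrisectionKernels

/-! ## Group trisections -/

/-- **Group trisection (Abrams–Gay–Kirby 2018, Def. 1), kernel form.** `K = (K₁,K₂,K₃)` is a
`(g, k)`-trisection of the group `G` if the `Kᵢ` are normal in `S_g`, each `Hᵢ = S_g/Kᵢ` is
free of rank `g`, each pairwise pushout `S_g/⟪Kᵢ ∪ Kⱼ⟫` (`i ≠ j`) is free of rank `k`, and the
triple pushout `S_g/⟪K₁ ∪ K₂ ∪ K₃⟫` is isomorphic to `G`. [cite: AbramsGayKirby2018, Def. 1] -/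
structure IsGroupTrisection (g k : ℕ) (G : Type*) [Group G] (K : TrisectionKernels g) : Prop where
  /-- the kernels are normal -/
  normal : ∀ i, (K i).Normal
  /-- `S_g / Kᵢ ≅ F_g` (quotient by the normal closure, equal to `Kᵢ` by `normal`) -/
  free_quotient : ∀ i, IsFreeOfRank (SurfaceGroup g ⧸ normalClosure (K i : Set (SurfaceGroup g))) g
  /-- `S_g / ⟪Kᵢ ∪ Kⱼ⟫ ≅ F_k` for `i ≠ j` -/
  free_pairQuotient : ∀ i j, i ≠ j → IsFreeOfRank (K.pairQuotient i j) k
  /-- the triple pushout is `G` -/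
  triple : Nonempty (K.tripleQuotient ≃* G)

/-- A **`(g,k)` group trisection of `G`** as data: a kernel triple with the trisection property and
a chosen identification of the triple pushout with `G` (Abrams–Gay–Kirby 2018, Def. 1).
[cite: AbramsGayKirby2018, Def. 1] -/
structure GroupTrisection (g k : ℕ) (G : Type*) [Group G] where
  /-- the three kernels `Kᵢ = ker (S_g ↠ Hᵢ)` -/
  K : TrisectionKernels g
  /-- the trisection conditions -/
  isGroupTrisection : IsGroupTrisection g k G K
  /-- the identification of the triple pushout with `G` -/
  iso : K.tripleQuotient ≃* G

namespace GroupTrisection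

variable {g k : ℕ} {G : Type*} [Group G]

/-- **From the printed form of Def. 1**: three surjections `φᵢ : S_g ↠ Hᵢ` onto free groups of
rank `g` whose pairwise pushouts are free of rank `k` and whose triple pushout is `G` give a group
trisection with kernels `ker φᵢ` (and `Hᵢ ≅ S_g / ker φᵢ`). [cite: AbramsGayKirby2018, Def. 1] -/
def ofHoms {H : Fin 3 → Type*} [∀ i, Group (H i)] (φ : ∀ i, SurfaceGroup g →* H i)
    (surj : ∀ i, Function.Surjective (φ i)) (free : ∀ i, IsFreeOfRank (H i) g)
    (pair : ∀ i j, i ≠ j →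
      IsFreeOfRank (TrisectionKernels.pairQuotient (fun i => (φ i).ker) i j) k)
    (e : TrisectionKernels.tripleQuotient (fun i => (φ i).ker) ≃* G) : GroupTrisection g k G where
  K := fun i => (φ i).ker
  isGroupTrisection :=
    { normal := fun _ => inferInstance
      free_quotient := fun i =>
        ((free i).of_mulEquiv (QuotientGroup.quotientKerEquivOfSurjective (φ i) (surj i)).symm).of_mulEquiv
          (QuotientGroup.quotientMulEquivOfEq (normalClosure_eq_self _).symm)
      free_pairQuotient := pair
      triple := ⟨e⟩ }
  iso := e

/-- Isomorphism of group trisections of the same type: isomorphism of their kernel triples.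
[cite: AbramsGayKirby2018, §2] -/
def Iso (T T' : GroupTrisection g k G) : Prop :=
  TrisectionKernels.Iso T.K T'.K

end GroupTrisection

/-! ## The trivial `(0,0)` trisection, the `S⁴` trisection, stabilisation -/

/-- The trivial kernel triple in genus `0`: all kernels `⊤` (`S_0` is the trivial group).
[cite: AbramsGayKirby2018, §1] -/
def trivialKernels : TrisectionKernels 0 := fun _ => ⊤

/-- `S_0` (no generators) is a subsingleton. [folklore] -/
instance : Subsingleton (SurfaceGroup 0) := by
  refine ⟨fun x y => ?_⟩
  obtain ⟨x, rfl⟩ := PresentedGroup.mk_surjective _ x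
  obtain ⟨y, rfl⟩ := PresentedGroup.mk_surjective _ y
  rw [Subsingleton.elim x y]

/-- A subsingleton group is free of rank `0`. [folklore] -/
theorem isFreeOfRank_zero_of_subsingleton (H : Type*) [Group H] [Subsingleton H] :
    IsFreeOfRank H 0 :=
  letI : Unique H := uniqueOfSubsingleton 1
  ⟨MulEquiv.ofUnique⟩

/-- Quotients of a subsingleton group are subsingletons. [folklore] -/
instance subsingleton_quotient_surfaceGroup_zero (N : Subgroup (SurfaceGroup 0)) [N.Normal] :
    Subsingleton (SurfaceGroup 0 ⧸ N) :=
  ⟨fun x y => by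
    obtain ⟨x, rfl⟩ := QuotientGroup.mk_surjective x
    obtain ⟨y, rfl⟩ := QuotientGroup.mk_surjective y
    rw [Subsingleton.elim x y]⟩

/-- **The `(0,0)` trisection of the trivial group** (Abrams–Gay–Kirby 2018, §1: corresponds to
`S⁴` with its genus-`0` trisection). [cite: AbramsGayKirby2018, §1] -/
def GroupTrisection.trivial : GroupTrisection 0 0 (PUnit : Type) where
  K := trivialKernels
  isGroupTrisection :=
    { normal := fun _ => Subgroup.normal_top
      free_quotient := fun _ => isFreeOfRank_zero_of_subsingleton _
      free_pairQuotient := fun _ _ _ => isFreeOfRank_zero_of_subsingleton _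
      triple := ⟨letI : Unique (trivialKernels.tripleQuotient) := uniqueOfSubsingleton 1
        MulEquiv.ofUnique⟩ }
  iso := letI : Unique (trivialKernels.tripleQuotient) := uniqueOfSubsingleton 1
    MulEquiv.ofUnique

/-- The kernels of the **genus-`3` trisection of `S⁴`** (the connected sum of the three unbalanced
genus-`1` trisections of `S⁴`; Gay–Kirby 2016, §1): with `S_3 = ⟨a₁,b₁,a₂,b₂,a₃,b₃⟩`,
`K₁ = ⟪a₁, a₂, b₃⟫`, `K₂ = ⟪a₁, b₂, a₃⟫`, `K₃ = ⟪b₁, a₂, a₃⟫` (each pair of cut systems shares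
exactly one curve, giving `k = 1`). [cite: GayKirby2016, §1 (genus-3 trisection of S⁴)] -/
def s4Kernels : TrisectionKernels 3 :=
  ![normalClosure {SurfaceGroup.a 0, SurfaceGroup.a 1, SurfaceGroup.b 2},
    normalClosure {SurfaceGroup.a 0, SurfaceGroup.b 1, SurfaceGroup.a 2},
    normalClosure {SurfaceGroup.b 0, SurfaceGroup.a 1, SurfaceGroup.a 2}]

/-- NAMED FACT: `s4Kernels` is a `(3,1)` group trisection of the trivial group (`S_3/Kᵢ ≅ F_3`
on the three surviving generators, `S_3/⟪Kᵢ ∪ Kⱼ⟫ ≅ F_1 = ℤ` on the single shared survivor, and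
everything dies in the triple quotient) — the group trisection of `S⁴` of genus `3`
(Abrams–Gay–Kirby 2018, §1; Gay–Kirby 2016, §1). A routine presentation computation, recorded as
a fact. Users take `(h : s4Kernels_isGroupTrisection)`. [cite: AbramsGayKirby2018, §1] -/
def s4Kernels_isGroupTrisection : Prop :=
  IsGroupTrisection 3 1 (PUnit : Type) s4Kernels

/-- The inclusion `S_g → S_{g+3}` on generators (`aᵢ ↦ aᵢ`, `bᵢ ↦ bᵢ`, `i < g`); the surface
relator of genus `g` maps into `⟪relator of genus g+3, a_{g+1},…⟫` only after killing the new
handles, so this is defined on the free group and used only to transport kernel *generators*.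
[folklore] -/
def genIncl (g : ℕ) : FreeGroup (surfaceGen g) →* FreeGroup (surfaceGen (g + 3)) :=
  FreeGroup.map fun p => (Fin.castAdd 3 p.1, p.2)

/-- The shift `S_3`-generators `↦` the last three handles of `S_{g+3}` (`aⱼ ↦ a_{g+j}`), on free
groups. [folklore] -/
def genShift (g : ℕ) : FreeGroup (surfaceGen 3) →* FreeGroup (surfaceGen (g + 3)) :=
  FreeGroup.map fun p => (Fin.natAdd g p.1, p.2)

/-- **Stabilisation of a kernel triple**, `K ↦ K # K_{S⁴,3}`: in `S_{g+3}`, the `i`-th kernel is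
the normal closure of (lifts to the free group of) `Kᵢ` pushed along `aⱼ ↦ aⱼ, bⱼ ↦ bⱼ` together
with the `i`-th `S⁴`-kernel on the three new handles (Abrams–Gay–Kirby 2018, §1–2, stabilisation
`T ↦ T # T_{S⁴,3}` of type `(g+3, k+1)`; Gay–Kirby 2016, §1). [cite: AbramsGayKirby2018, §2 (stabilisation)] -/
def TrisectionKernels.stabilize {g : ℕ} (K : TrisectionKernels g) : TrisectionKernels (g + 3) :=
  fun i => normalClosure
    ((PresentedGroup.mk _ ∘ genIncl g) '' ((PresentedGroup.mk _) ⁻¹' (K i : Set (SurfaceGroup g))) ∪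
      (PresentedGroup.mk _ ∘ genShift g) '' ((PresentedGroup.mk _) ⁻¹' (s4Kernels i : Set (SurfaceGroup 3))))

/-- NAMED FACT: stabilisation turns a `(g,k)` trisection of `G` into a `(g+3, k+1)` trisection of
`G` (Abrams–Gay–Kirby 2018, Def. 3; Gay–Kirby 2016, §1); discharged below by
`stabilize_isGroupTrisection_holds`. Users take `(h : stabilize_isGroupTrisection)`.
[cite: AbramsGayKirby2018, Def. 3 (stabilisation)] -/
def stabilize_isGroupTrisection : Prop :=
  ∀ (g k : ℕ) (G : Type) [Group G] (K : TrisectionKernels g),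
    IsGroupTrisection g k G K → IsGroupTrisection (g + 3) (k + 1) G K.stabilize

/-- `n`-fold stabilisation, landing in genus `g + 3 n`. [cite: AbramsGayKirby2018, §2] -/
def TrisectionKernels.stabilizeIter {g : ℕ} (K : TrisectionKernels g) :
    (n : ℕ) → TrisectionKernels (g + 3 * n)
  | 0 => K
  | n + 1 => (K.stabilizeIter n).stabilize

/-- **Stably trivial** kernel triple / trisection of the trivial group: after some number of
stabilisations it becomes isomorphic to a stabilisation of the genus-`3` `S⁴` trisection of the
same genus (Abrams–Gay–Kirby 2018, Thm. 5 area: SPC4 ⟺ every trisection of the trivial group is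
stably trivial). The genus bookkeeping `g + 3n = 3 + 3m` is an explicit equation used to
transport. [cite: AbramsGayKirby2018, §2 (stable equivalence)] -/
def TrisectionKernels.IsStablyTrivial {g : ℕ} (K : TrisectionKernels g) : Prop :=
  ∃ (n m : ℕ) (h : 3 + 3 * m = g + 3 * n),
    TrisectionKernels.Iso (K.stabilizeIter n) ((s4Kernels.stabilizeIter m).cast h)

/-- The `S⁴` trisection is stably trivial (with no stabilisation at all). [folklore] -/
theorem s4Kernels_isStablyTrivial : s4Kernels.IsStablyTrivial :=
  ⟨0, 0, rfl, TrisectionKernels.Iso.refl _⟩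

/-! ## Discharge of `s4Kernels_isGroupTrisection`

Killing a set `S` of generators of `S_g` that meets every handle (`aᵢ ∈ S` or `bᵢ ∈ S` for each
`i`) kills the surface relator `∏ [aᵢ, bᵢ]`, so the quotient of `S_g` by any normal subgroup
containing these generators and killed by the erasing map is the free group on the surviving
generators (`quotientEquivFreeGroupErase`). Applied to the seven quotients attached to `s4Kernels`
(three single kernels: `3` survivors; three pairs: `1` survivor; the triple: none) this proves
`s4Kernels_isGroupTrisection_holds` (Abrams–Gay–Kirby 2018, §1 and Fig. 1: "the standard trivial
`(3,1)`-trisection" of `{1}`, corresponding to the genus-`3` trisection of `S⁴` under Thm. 5). -/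

section Erase

variable {g : ℕ}

/-- The generator-erasing map `surfaceGen g → F⟨generators not in S⟩`: `x ↦ 1` for `x ∈ S`,
`x ↦ x` otherwise. [folklore] -/
def eraseGen (S : Finset (surfaceGen g)) (x : surfaceGen g) : FreeGroup {x // x ∉ S} :=
  if h : x ∈ S then 1 else FreeGroup.of ⟨x, h⟩

/-- Erased generators go to `1`. [folklore] -/
theorem eraseGen_of_mem {S : Finset (surfaceGen g)} {x : surfaceGen g} (h : x ∈ S) :
    eraseGen S x = 1 := dif_pos h

/-- Surviving generators go to themselves. [folklore] -/
theorem eraseGen_of_not_mem {S : Finset (surfaceGen g)} {x : surfaceGen g} (h : x ∉ S) :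
    eraseGen S x = FreeGroup.of ⟨x, h⟩ := dif_neg h

/-- If `S` meets every handle (`aᵢ ∈ S` or `bᵢ ∈ S` for all `i`), erasing `S` kills the surface
relator. [folklore] -/
theorem lift_eraseGen_surfaceRelator (S : Finset (surfaceGen g))
    (hS : ∀ i : Fin g, (i, false) ∈ S ∨ (i, true) ∈ S) :
    FreeGroup.lift (eraseGen S) (surfaceRelator g) = 1 := by
  unfold surfaceRelator
  rw [map_list_prod, List.map_map]
  apply List.prod_eq_one
  intro x hx
  rw [List.mem_map] at hx
  obtain ⟨i, -, rfl⟩ := hx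
  rcases hS i with h | h
  · simp [genA, eraseGen_of_mem h]
  · simp [genB, eraseGen_of_mem h]

/-- The erasing homomorphism `S_g →* F⟨generators not in S⟩` (well defined when `S` meets every
handle). [folklore] -/
def eraseHom (S : Finset (surfaceGen g)) (hS : ∀ i : Fin g, (i, false) ∈ S ∨ (i, true) ∈ S) :
    SurfaceGroup g →* FreeGroup {x // x ∉ S} :=
  PresentedGroup.toGroup (f := eraseGen S) (by
    intro r hr
    rw [Set.mem_singleton_iff] at hr
    subst hr
    exact lift_eraseGen_surfaceRelator S hS)

/-- `eraseHom` on generators. [folklore] -/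
@[simp] theorem eraseHom_of (S : Finset (surfaceGen g))
    (hS : ∀ i : Fin g, (i, false) ∈ S ∨ (i, true) ∈ S) (x : surfaceGen g) :
    eraseHom S hS (PresentedGroup.of x) = eraseGen S x :=
  PresentedGroup.toGroup.of _

/-- Erased generators lie in the kernel of `eraseHom`. [folklore] -/
theorem of_mem_ker_eraseHom (S : Finset (surfaceGen g))
    (hS : ∀ i : Fin g, (i, false) ∈ S ∨ (i, true) ∈ S) {x : surfaceGen g} (hx : x ∈ S) :
    (PresentedGroup.of x : SurfaceGroup g) ∈ (eraseHom S hS).ker := by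
  rw [MonoidHom.mem_ker, eraseHom_of, eraseGen_of_mem hx]

/-- **Killing generators of a surface group.** If `S` meets every handle and `N ⊴ S_g` contains the
generators in `S` and is killed by the erasing map, then `S_g ⧸ N ≅ F⟨generators not in S⟩`.
[folklore] -/
def quotientEquivFreeGroupErase (S : Finset (surfaceGen g))
    (hS : ∀ i : Fin g, (i, false) ∈ S ∨ (i, true) ∈ S) (N : Subgroup (SurfaceGroup g)) [N.Normal]
    (hN₁ : ∀ x ∈ S, (PresentedGroup.of x : SurfaceGroup g) ∈ N) (hN₂ : N ≤ (eraseHom S hS).ker) :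
    SurfaceGroup g ⧸ N ≃* FreeGroup {x // x ∉ S} :=
  MonoidHom.toMulEquiv (QuotientGroup.lift N (eraseHom S hS) hN₂)
    (FreeGroup.lift fun x => (QuotientGroup.mk (PresentedGroup.of x.1) : SurfaceGroup g ⧸ N))
    (by
      apply QuotientGroup.monoidHom_ext
      apply PresentedGroup.ext
      intro x
      simp only [MonoidHom.comp_apply, QuotientGroup.mk'_apply, QuotientGroup.lift_mk, eraseHom_of,
        MonoidHom.id_apply]
      by_cases hx : x ∈ S
      · rw [eraseGen_of_mem hx, map_one, eq_comm, QuotientGroup.eq_one_iff]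
        exact hN₁ x hx
      · rw [eraseGen_of_not_mem hx, FreeGroup.lift_apply_of])
    (by
      apply FreeGroup.ext_hom
      rintro ⟨x, hx⟩
      simp only [MonoidHom.comp_apply, FreeGroup.lift_apply_of, QuotientGroup.lift_mk, eraseHom_of,
        MonoidHom.id_apply, eraseGen_of_not_mem hx])

/-- Rank count for `quotientEquivFreeGroupErase`. [folklore] -/
theorem isFreeOfRank_quotient_of_erase (S : Finset (surfaceGen g))
    (hS : ∀ i : Fin g, (i, false) ∈ S ∨ (i, true) ∈ S) (N : Subgroup (SurfaceGroup g)) [N.Normal]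
    (hN₁ : ∀ x ∈ S, (PresentedGroup.of x : SurfaceGroup g) ∈ N) (hN₂ : N ≤ (eraseHom S hS).ker)
    {n : ℕ} (hn : Fintype.card {x // x ∉ S} = n) :
    IsFreeOfRank (SurfaceGroup g ⧸ N) n :=
  ⟨(FreeGroup.freeGroupCongr (Fintype.equivFinOfCardEq hn)).symm.trans
    (quotientEquivFreeGroupErase S hS N hN₁ hN₂).symm⟩

end Erase

/-! ### The `S⁴` computation -/

/-- The generators killed by the kernels `K₁, K₂, K₃` of `s4Kernels`: `{a₁,a₂,b₃}`, `{a₁,b₂,a₃}`,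
`{b₁,a₂,a₃}` (as elements of `surfaceGen 3 = Fin 3 × Bool`). [cite: AbramsGayKirby2018, §1, Fig. 1] -/
def s4Gens : Fin 3 → Finset (surfaceGen 3) :=
  ![{((0 : Fin 3), false), ((1 : Fin 3), false), ((2 : Fin 3), true)},
    {((0 : Fin 3), false), ((1 : Fin 3), true), ((2 : Fin 3), false)},
    {((0 : Fin 3), true), ((1 : Fin 3), false), ((2 : Fin 3), false)}]

/-- `s4Kernels i` is the normal closure of the generators in `s4Gens i`. [folklore] -/
theorem s4Kernels_eq (i : Fin 3) :
    s4Kernels i = normalClosure (PresentedGroup.of '' (s4Gens i : Set (surfaceGen 3))) := by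
  fin_cases i <;>
    simp [s4Kernels, s4Gens, Set.image_insert_eq, Set.image_singleton, SurfaceGroup.a, SurfaceGroup.b]

/-- The generators in `s4Gens i` lie in `s4Kernels i`. [folklore] -/
theorem of_mem_s4Kernels (i : Fin 3) {x : surfaceGen 3} (hx : x ∈ s4Gens i) :
    (PresentedGroup.of x : SurfaceGroup 3) ∈ s4Kernels i := by
  rw [s4Kernels_eq]
  exact subset_normalClosure ⟨x, hx, rfl⟩

/-- Each `s4Gens i` meets every handle. [folklore] -/
theorem s4Gens_hits (i k : Fin 3) : (k, false) ∈ s4Gens i ∨ (k, true) ∈ s4Gens i := by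
  fin_cases i <;> fin_cases k <;> decide

/-- Every generator is killed by some kernel. [folklore] -/
theorem s4Gens_cover (x : surfaceGen 3) : ∃ i, x ∈ s4Gens i := by
  obtain ⟨k, b⟩ := x
  fin_cases k <;> cases b <;> decide

/-- `s4Kernels i` is killed by erasing any `S ⊇ s4Gens i`. [folklore] -/
theorem s4Kernels_le_ker (S : Finset (surfaceGen 3))
    (hS : ∀ k : Fin 3, (k, false) ∈ S ∨ (k, true) ∈ S) (i : Fin 3) (h : s4Gens i ⊆ S) :
    s4Kernels i ≤ (eraseHom S hS).ker := by
  rw [s4Kernels_eq]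
  refine normalClosure_le_normal ?_
  rintro _ ⟨x, hx, rfl⟩
  exact of_mem_ker_eraseHom S hS (h hx)

/-- Three generators survive a single kernel. [folklore] -/
theorem card_compl_s4Gens (i : Fin 3) : Fintype.card {x // x ∉ s4Gens i} = 3 := by
  fin_cases i <;> decide

/-- One generator survives two distinct kernels. [folklore] -/
theorem card_compl_s4Gens_union (i j : Fin 3) (hij : i ≠ j) :
    Fintype.card {x // x ∉ s4Gens i ∪ s4Gens j} = 1 := by
  fin_cases i <;> fin_cases j <;> first | exact absurd rfl hij | decide

/-- **`s4Kernels` is a `(3,1)` group trisection of the trivial group** (discharge of the named fact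
`s4Kernels_isGroupTrisection`; Abrams–Gay–Kirby 2018, §1 and Fig. 1, "the standard trivial
`(3,1)`-trisection" of `{1}`, the group trisection of the genus-`3` trisection of `S⁴`). Killing `a₁,a₂,b₃` (resp. `a₁,b₂,a₃`, `b₁,a₂,a₃`) in `S_3` kills the surface
relator and leaves the free group on the three surviving generators; killing two of the kernels
leaves one surviving generator (`F_1 = ℤ`); killing all three leaves nothing.
[cite: AbramsGayKirby2018, §1, Fig. 1] -/
theorem s4Kernels_isGroupTrisection_holds : s4Kernels_isGroupTrisection where
  normal i := by rw [s4Kernels_eq]; infer_instance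
  free_quotient i :=
    isFreeOfRank_quotient_of_erase (s4Gens i) (s4Gens_hits i) _
      (fun _ hx => subset_normalClosure (of_mem_s4Kernels i hx))
      (normalClosure_le_normal (s4Kernels_le_ker _ _ i le_rfl)) (card_compl_s4Gens i)
  free_pairQuotient i j hij := by
    refine isFreeOfRank_quotient_of_erase (s4Gens i ∪ s4Gens j)
      (fun k => (s4Gens_hits i k).imp (Finset.mem_union_left _) (Finset.mem_union_left _)) _
      ?_ ?_ (card_compl_s4Gens_union i j hij)
    · intro x hx
      rw [Finset.mem_union] at hx
      rcases hx with hx | hx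
      · exact subset_normalClosure (Or.inl (of_mem_s4Kernels i hx))
      · exact subset_normalClosure (Or.inr (of_mem_s4Kernels j hx))
    · exact normalClosure_le_normal (Set.union_subset
        (s4Kernels_le_ker _ _ i Finset.subset_union_left)
        (s4Kernels_le_ker _ _ j Finset.subset_union_right))
  triple := by
    haveI : IsEmpty {x : surfaceGen 3 // x ∉ (Finset.univ : Finset (surfaceGen 3))} :=
      ⟨fun x => x.2 (Finset.mem_univ _)⟩
    refine ⟨(quotientEquivFreeGroupErase Finset.univ (fun k => Or.inl (Finset.mem_univ _)) _
      ?_ ?_).trans MulEquiv.ofUnique⟩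
    · intro x _
      obtain ⟨i, hi⟩ := s4Gens_cover x
      exact subset_normalClosure (Set.mem_iUnion.2 ⟨i, of_mem_s4Kernels i hi⟩)
    · exact normalClosure_le_normal (Set.iUnion_subset fun i =>
        s4Kernels_le_ker _ _ i (Finset.subset_univ _))

end Literature.Topology.FourManifolds

end

noncomputable section

namespace Literature.Topology.FourManifolds

open Subgroup Monoid Monoid.Coprod

/-! ## Proofs: stabilisation preserves the trisection property

Architecture (Abrams–Gay–Kirby 2018, Def. 2–3): the connected sum of group trisections is the
slot-wise free product, and the stabilisation is the connected sum with the standard trivial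
`(3,1)`-trisection; hence the vertex groups of the stabilised cube are `F_g ∗ F_3 = F_{g+3}`,
`F_k ∗ F_1 = F_{k+1}` and `G ∗ 1 = G`. -/

/-! ### Free products of free groups -/

/-- `F(α) ∗ F(β) ≅ F(α ⊕ β)`. [folklore] -/
def freeGroupCoprodEquiv (α β : Type*) :
    FreeGroup α ∗ FreeGroup β ≃* FreeGroup (α ⊕ β) :=
  MonoidHom.toMulEquiv
    (Coprod.lift (FreeGroup.map Sum.inl) (FreeGroup.map Sum.inr))
    (FreeGroup.lift (Sum.elim (fun a => inl (FreeGroup.of a)) (fun b => inr (FreeGroup.of b))))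
    (Coprod.hom_ext (FreeGroup.ext_hom _ _ fun a => by simp)
      (FreeGroup.ext_hom _ _ fun b => by simp))
    (FreeGroup.ext_hom _ _ (by rintro (a | b) <;> simp))

/-- The free product of free groups of ranks `m` and `n` is free of rank `m + n`. [folklore] -/
theorem IsFreeOfRank.coprod {P Q : Type*} [Group P] [Group Q] {m n : ℕ}
    (hP : IsFreeOfRank P m) (hQ : IsFreeOfRank Q n) : IsFreeOfRank (P ∗ Q) (m + n) := by
  obtain ⟨eP⟩ := hP
  obtain ⟨eQ⟩ := hQ
  exact ⟨(FreeGroup.freeGroupCongr finSumFinEquiv).symm.trans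
    ((freeGroupCoprodEquiv (Fin m) (Fin n)).symm.trans (MulEquiv.coprodCongr eP eQ))⟩

/-- The free product with a trivial group changes nothing: `P ∗ 1 ≅ P ≅ G`. [folklore] -/
def coprodEquivOfSubsingleton {P Q G : Type*} [Group P] [Group Q] [Group G] [Subsingleton Q]
    (e : P ≃* G) : P ∗ Q ≃* G :=
  letI : Unique Q := uniqueOfSubsingleton 1
  (MulEquiv.coprodCongr e (MulEquiv.ofUnique : Q ≃* (PUnit : Type))).trans
    (MulEquiv.coprodPUnit G)

/-! ### Splitting the surface relator of genus `g + 3` -/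

/-- `genIncl` on a generator: `aᵢ ↦ aᵢ`, `bᵢ ↦ bᵢ`. [folklore] -/
@[simp] theorem genIncl_of (g : ℕ) (p : surfaceGen g) :
    genIncl g (FreeGroup.of p) = FreeGroup.of (Fin.castAdd 3 p.1, p.2) := by
  simp [genIncl, FreeGroup.map.of]

/-- `genShift` on a generator: `aⱼ ↦ a_{g+j}`, `bⱼ ↦ b_{g+j}`. [folklore] -/
@[simp] theorem genShift_of (g : ℕ) (p : surfaceGen 3) :
    genShift g (FreeGroup.of p) = FreeGroup.of (Fin.natAdd g p.1, p.2) := by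
  simp [genShift, FreeGroup.map.of]

/-- `r_{g+3} = ι(r_g) · σ(r_3)` in the free group on the genus-`g+3` generators. [folklore] -/
theorem surfaceRelator_add_three (g : ℕ) :
    surfaceRelator (g + 3) = genIncl g (surfaceRelator g) * genShift g (surfaceRelator 3) := by
  simp only [surfaceRelator, map_list_prod, List.map_ofFn, ← List.prod_append, ← List.ofFn_eq_map]
  rw [← List.ofFn_fin_append]
  refine congrArg List.prod (congrArg List.ofFn ((Fin.append_castAdd_natAdd).symm.trans ?_))
  congr 1

/-! ### Homs out of presented groups and their quotients -/

section presented

variable {α T : Type*} [Group T] {rels : Set (FreeGroup α)}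

/-- `FreeGroup.lift` of the restriction of a hom to generators is that hom. [folklore] -/
theorem freeGroup_lift_comp_of (Φ : FreeGroup α →* T) : FreeGroup.lift (⇑Φ ∘ FreeGroup.of) = Φ :=
  FreeGroup.ext_hom _ _ fun a => by simp

/-- A hom `Φ` out of the free group killing the relators descends to the presented group.
[folklore] -/
def presentedLift (Φ : FreeGroup α →* T) (h : ∀ r ∈ rels, Φ r = 1) : PresentedGroup rels →* T :=
  PresentedGroup.toGroup (f := ⇑Φ ∘ FreeGroup.of) (by rw [freeGroup_lift_comp_of]; exact h)

/-- `presentedLift Φ` on the class of a word is `Φ` of the word. [folklore] -/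
@[simp] theorem presentedLift_mk (Φ : FreeGroup α →* T) (h : ∀ r ∈ rels, Φ r = 1)
    (x : FreeGroup α) :
    presentedLift Φ h (PresentedGroup.mk rels x) = Φ x := by
  change FreeGroup.lift _ x = _
  rw [freeGroup_lift_comp_of]

/-- `presentedLift Φ` on a generator. [folklore] -/
@[simp] theorem presentedLift_of (Φ : FreeGroup α →* T) (h : ∀ r ∈ rels, Φ r = 1) (a : α) :
    presentedLift Φ h (PresentedGroup.of (rels := rels) a) = Φ (FreeGroup.of a) :=
  presentedLift_mk Φ h _

end presented

section transfer

variable {n m : ℕ} (ψ : FreeGroup (surfaceGen n) →* FreeGroup (surfaceGen m))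
  (S : Set (SurfaceGroup n)) (N : Subgroup (SurfaceGroup m)) [N.Normal]

/-- Push `S_n ⧸ ⟪S⟫` to `S_m ⧸ N` along a free-group hom `ψ` on generators, when `1 ∈ S` and `ψ`
sends lifts of `S` into `N`. [folklore] -/
def quotientTransfer (h1 : (1 : SurfaceGroup n) ∈ S)
    (hN : ∀ x, PresentedGroup.mk _ x ∈ S → PresentedGroup.mk _ (ψ x) ∈ N) :
    SurfaceGroup n ⧸ normalClosure S →* SurfaceGroup m ⧸ N :=
  QuotientGroup.lift _
    (presentedLift ((QuotientGroup.mk' N).comp ((PresentedGroup.mk _).comp ψ)) (by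
      intro r hr
      rw [Set.mem_singleton_iff] at hr
      subst hr
      simpa using hN _ (by rwa [PresentedGroup.one_of_mem (Set.mem_singleton _)])))
    (normalClosure_le_normal fun s hs => by
      obtain ⟨x, rfl⟩ := PresentedGroup.mk_surjective _ s
      simpa using hN _ hs)

/-- `quotientTransfer ψ` on the class of a word `x` is the class of `ψ x`. [folklore] -/
@[simp] theorem quotientTransfer_mk_mk (h1 : (1 : SurfaceGroup n) ∈ S)
    (hN : ∀ x, PresentedGroup.mk _ x ∈ S → PresentedGroup.mk _ (ψ x) ∈ N)
    (x : FreeGroup (surfaceGen n)) :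
    quotientTransfer ψ S N h1 hN ((PresentedGroup.mk _ x : SurfaceGroup n) : _ ⧸ normalClosure S) =
      ((PresentedGroup.mk _ (ψ x) : SurfaceGroup m) : _ ⧸ N) := by
  simp [quotientTransfer]

end transfer

section stab

variable {g : ℕ} (S : Set (SurfaceGroup g)) (S' : Set (SurfaceGroup 3))

/-- The generating set of a stabilised kernel: lifts of `S` re-embedded on the first `g` handles,
together with lifts of `S'` on the last three. [cite: AbramsGayKirby2018, Def. 2] -/
def stabSet : Set (SurfaceGroup (g + 3)) :=
  (PresentedGroup.mk _ ∘ genIncl g) '' ((PresentedGroup.mk _) ⁻¹' S) ∪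
    (PresentedGroup.mk _ ∘ genShift g) '' ((PresentedGroup.mk _) ⁻¹' S')

/-- Unfolding `stabilize` in terms of `stabSet`. [folklore] -/
theorem TrisectionKernels.stabilize_apply (K : TrisectionKernels g) (i : Fin 3) :
    K.stabilize i = normalClosure (stabSet (K i) (s4Kernels i)) := rfl

/-- `stabSet` commutes with binary unions. [folklore] -/
theorem stabSet_union (S₁ S₂ : Set (SurfaceGroup g)) (S'₁ S'₂ : Set (SurfaceGroup 3)) :
    stabSet (S₁ ∪ S₂) (S'₁ ∪ S'₂) = stabSet S₁ S'₁ ∪ stabSet S₂ S'₂ := by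
  simp only [stabSet, Set.preimage_union, Set.image_union]
  exact Set.union_union_union_comm _ _ _ _

/-- `stabSet` commutes with indexed unions. [folklore] -/
theorem stabSet_iUnion {ι : Type*} (T : ι → Set (SurfaceGroup g))
    (T' : ι → Set (SurfaceGroup 3)) :
    stabSet (⋃ i, T i) (⋃ i, T' i) = ⋃ i, stabSet (T i) (T' i) := by
  simp only [stabSet, Set.preimage_iUnion, Set.image_iUnion, Set.iUnion_union_distrib]

/-- The stabilised quotient `S_{g+3} ⧸ ⟪stabSet S S'⟫`. [cite: AbramsGayKirby2018, Def. 2] -/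
abbrev StabQuotient : Type := SurfaceGroup (g + 3) ⧸ normalClosure (stabSet S S')

/-- `S_g ⧸ ⟪S⟫ → S_{g+3} ⧸ ⟪stabSet S S'⟫` on the first `g` handles. [folklore] -/
def stabInl (h1 : (1 : SurfaceGroup g) ∈ S) :
    SurfaceGroup g ⧸ normalClosure S →* StabQuotient S S' :=
  quotientTransfer (genIncl g) S _ h1 fun x hx =>
    subset_normalClosure (Or.inl ⟨x, hx, rfl⟩)

/-- `S_3 ⧸ ⟪S'⟫ → S_{g+3} ⧸ ⟪stabSet S S'⟫` on the last three handles. [folklore] -/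
def stabInr (h1' : (1 : SurfaceGroup 3) ∈ S') :
    SurfaceGroup 3 ⧸ normalClosure S' →* StabQuotient S S' :=
  quotientTransfer (genShift g) S' _ h1' fun x hx =>
    subset_normalClosure (Or.inr ⟨x, hx, rfl⟩)

/-- `stabInl` on a generator. [folklore] -/
@[simp] theorem stabInl_mk_of (h1 : (1 : SurfaceGroup g) ∈ S) (p : surfaceGen g) :
    stabInl S S' h1 ((PresentedGroup.of p : SurfaceGroup g) : _ ⧸ normalClosure S) =
      ((PresentedGroup.of (Fin.castAdd 3 p.1, p.2) : SurfaceGroup (g + 3)) :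
        StabQuotient S S') := by
  simp [stabInl, PresentedGroup.of]

/-- `stabInr` on a generator. [folklore] -/
@[simp] theorem stabInr_mk_of (h1' : (1 : SurfaceGroup 3) ∈ S') (p : surfaceGen 3) :
    stabInr S S' h1' ((PresentedGroup.of p : SurfaceGroup 3) : _ ⧸ normalClosure S') =
      ((PresentedGroup.of (Fin.natAdd g p.1, p.2) : SurfaceGroup (g + 3)) : StabQuotient S S') := by
  simp [stabInr, PresentedGroup.of]

variable {S S'}

section lift

variable {T : Type*} [Group T] (f : SurfaceGroup g ⧸ normalClosure S →* T)
  (f' : SurfaceGroup 3 ⧸ normalClosure S' →* T)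

/-- The generator assignment of the universal map out of the stabilised quotient. [folklore] -/
def stabLiftFun (c : surfaceGen (g + 3)) : T :=
  Fin.append (fun i => f (QuotientGroup.mk' _ (PresentedGroup.of (i, c.2))))
    (fun j => f' (QuotientGroup.mk' _ (PresentedGroup.of (j, c.2)))) c.1

/-- The free lift of `stabLiftFun f f'` restricted to the first `g` handles factors through `f`.
[folklore] -/
theorem lift_stabLiftFun_comp_genIncl :
    (FreeGroup.lift (stabLiftFun f f')).comp (genIncl g) =
      f.comp ((QuotientGroup.mk' _).comp (PresentedGroup.mk _)) :=
  FreeGroup.ext_hom _ _ fun p => by simp [stabLiftFun, PresentedGroup.of]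

/-- The free lift of `stabLiftFun f f'` restricted to the last three handles factors through
`f'`. [folklore] -/
theorem lift_stabLiftFun_comp_genShift :
    (FreeGroup.lift (stabLiftFun f f')).comp (genShift g) =
      f'.comp ((QuotientGroup.mk' _).comp (PresentedGroup.mk _)) :=
  FreeGroup.ext_hom _ _ fun p => by simp [stabLiftFun, PresentedGroup.of]

/-- Pointwise form of `lift_stabLiftFun_comp_genIncl`. [folklore] -/
theorem lift_stabLiftFun_genIncl (x : FreeGroup (surfaceGen g)) :
    FreeGroup.lift (stabLiftFun f f') (genIncl g x) =
      f (QuotientGroup.mk' _ (PresentedGroup.mk _ x)) :=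
  DFunLike.congr_fun (lift_stabLiftFun_comp_genIncl f f') x

/-- Pointwise form of `lift_stabLiftFun_comp_genShift`. [folklore] -/
theorem lift_stabLiftFun_genShift (x : FreeGroup (surfaceGen 3)) :
    FreeGroup.lift (stabLiftFun f f') (genShift g x) =
      f' (QuotientGroup.mk' _ (PresentedGroup.mk _ x)) :=
  DFunLike.congr_fun (lift_stabLiftFun_comp_genShift f f') x

/-- The universal map `S_{g+3} ⧸ ⟪stabSet S S'⟫ → T` determined by `f` and `f'`. [folklore] -/
def stabLift : StabQuotient S S' →* T :=
  QuotientGroup.lift _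
    (presentedLift (FreeGroup.lift (stabLiftFun f f')) (by
      intro r hr
      rw [Set.mem_singleton_iff] at hr
      subst hr
      rw [surfaceRelator_add_three, map_mul, lift_stabLiftFun_genIncl, lift_stabLiftFun_genShift,
        PresentedGroup.one_of_mem (Set.mem_singleton _),
        PresentedGroup.one_of_mem (Set.mem_singleton _)]
      simp))
    (normalClosure_le_normal (by
      rintro s (⟨x, hx, rfl⟩ | ⟨x, hx, rfl⟩)
      · rw [SetLike.mem_coe, MonoidHom.mem_ker, Function.comp_apply, presentedLift_mk,
          lift_stabLiftFun_genIncl, QuotientGroup.mk'_apply,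
          (QuotientGroup.eq_one_iff ((PresentedGroup.mk _) x)).2
            (subset_normalClosure (s := S) hx),
          map_one]
      · rw [SetLike.mem_coe, MonoidHom.mem_ker, Function.comp_apply, presentedLift_mk,
          lift_stabLiftFun_genShift, QuotientGroup.mk'_apply,
          (QuotientGroup.eq_one_iff ((PresentedGroup.mk _) x)).2
            (subset_normalClosure (s := S') hx),
          map_one]))

/-- `stabLift f f'` on a generator. [folklore] -/
@[simp] theorem stabLift_mk_of (c : surfaceGen (g + 3)) :
    stabLift f f' ((PresentedGroup.of c : SurfaceGroup (g + 3)) : StabQuotient S S') =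
      stabLiftFun f f' c := by
  simp [stabLift]

end lift

/-- Two homs out of the stabilised quotient agreeing on all generators are equal. [folklore] -/
theorem stabQuotient_hom_ext {T : Type*} [Group T] {φ χ : StabQuotient S S' →* T}
    (h : ∀ c, φ (QuotientGroup.mk' _ (PresentedGroup.of c)) =
      χ (QuotientGroup.mk' _ (PresentedGroup.of c))) :
    φ = χ :=
  QuotientGroup.monoidHom_ext _ (PresentedGroup.ext h)

variable (S S') (h1 : (1 : SurfaceGroup g) ∈ S) (h1' : (1 : SurfaceGroup 3) ∈ S')

/-- **The stabilised quotient is the free product** `(S_g ⧸ ⟪S⟫) ∗ (S_3 ⧸ ⟪S'⟫)`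
(Abrams–Gay–Kirby 2018, Def. 2: the vertex groups of a connected sum are free products).
[cite: AbramsGayKirby2018, Def. 2] -/
def stabQuotientEquivCoprod :
    StabQuotient S S' ≃* (SurfaceGroup g ⧸ normalClosure S) ∗ (SurfaceGroup 3 ⧸ normalClosure S') :=
  MonoidHom.toMulEquiv (stabLift inl inr) (Coprod.lift (stabInl S S' h1) (stabInr S S' h1'))
    (stabQuotient_hom_ext fun c => by
      obtain ⟨i, b⟩ := c
      refine Fin.addCases (fun i => ?_) (fun j => ?_) i
      · simp [stabLiftFun]
      · simp [stabLiftFun])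
    (Coprod.hom_ext
      (QuotientGroup.monoidHom_ext _ (PresentedGroup.ext fun p => by simp [stabLiftFun]))
      (QuotientGroup.monoidHom_ext _ (PresentedGroup.ext fun p => by simp [stabLiftFun])))

end stab

/-! ### Normal closures of unions -/

section nc

variable {G : Type*} [Group G]

/-- `⟪⟪A⟫ ∪ ⟪B⟫⟫ = ⟪A ∪ B⟫`. [folklore] -/
theorem normalClosure_union_normalClosure (A B : Set G) :
    normalClosure ((normalClosure A : Set G) ∪ normalClosure B) = normalClosure (A ∪ B) := by
  apply le_antisymm
  · exact normalClosure_le_normal (Set.union_subset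
      (SetLike.coe_subset_coe.2 (normalClosure_mono Set.subset_union_left))
      (SetLike.coe_subset_coe.2 (normalClosure_mono Set.subset_union_right)))
  · exact normalClosure_mono (Set.union_subset_union subset_normalClosure subset_normalClosure)

/-- `⟪⋃ᵢ ⟪Aᵢ⟫⟫ = ⟪⋃ᵢ Aᵢ⟫`. [folklore] -/
theorem normalClosure_iUnion_normalClosure {ι : Sort*} (A : ι → Set G) :
    normalClosure (⋃ i, (normalClosure (A i) : Set G)) = normalClosure (⋃ i, A i) := by
  apply le_antisymm
  · exact normalClosure_le_normal (Set.iUnion_subset fun i =>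
      SetLike.coe_subset_coe.2 (normalClosure_mono (Set.subset_iUnion A i)))
  · exact normalClosure_mono (Set.iUnion_mono fun i => subset_normalClosure)

end nc

/-! ### Assembly -/

/-- DISCHARGE of the named fact `stabilize_isGroupTrisection`: stabilisation turns a `(g,k)`
trisection of `G` into a `(g+3,k+1)` trisection of `G` (Abrams–Gay–Kirby 2018, Def. 3: "the
stabilization of a `(g,k)`-trisection of `G` is a `(g+3,k+1)`-trisection of the same group
`G = G ∗ {1}`"). Proof: each vertex group of the stabilised cube is the free product of the
corresponding vertex groups (`stabQuotientEquivCoprod`), and `F_g ∗ F_3 ≅ F_{g+3}`,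
`F_k ∗ F_1 ≅ F_{k+1}`, `G ∗ 1 ≅ G`. [cite: AbramsGayKirby2018, Def. 2–3] -/
theorem stabilize_isGroupTrisection_holds : stabilize_isGroupTrisection := by
  intro g k G _ K hK
  refine ⟨fun i => ?_, fun i => ?_, fun i j hij => ?_, ?_⟩
  · rw [TrisectionKernels.stabilize_apply]
    infer_instance
  · have e := stabQuotientEquivCoprod (K i : Set (SurfaceGroup g))
      (s4Kernels i : Set (SurfaceGroup 3)) (one_mem _) (one_mem _)
    have h := (hK.free_quotient i).coprod (s4Kernels_isGroupTrisection_holds.free_quotient i)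
    refine (h.of_mulEquiv e.symm).of_mulEquiv (QuotientGroup.quotientMulEquivOfEq ?_)
    rw [TrisectionKernels.stabilize_apply, normalClosure_idempotent]
  · have e := stabQuotientEquivCoprod ((K i : Set (SurfaceGroup g)) ∪ K j)
      ((s4Kernels i : Set (SurfaceGroup 3)) ∪ s4Kernels j) (Or.inl (one_mem _)) (Or.inl (one_mem _))
    have h := (hK.free_pairQuotient i j hij).coprod
      (s4Kernels_isGroupTrisection_holds.free_pairQuotient i j hij)
    refine (h.of_mulEquiv e.symm).of_mulEquiv (QuotientGroup.quotientMulEquivOfEq ?_)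
    rw [TrisectionKernels.stabilize_apply, TrisectionKernels.stabilize_apply,
      normalClosure_union_normalClosure, stabSet_union]
  · have e := stabQuotientEquivCoprod (⋃ i, (K i : Set (SurfaceGroup g)))
      (⋃ i, (s4Kernels i : Set (SurfaceGroup 3))) (Set.mem_iUnion.2 ⟨0, one_mem _⟩)
      (Set.mem_iUnion.2 ⟨0, one_mem _⟩)
    obtain ⟨eG⟩ := hK.triple
    obtain ⟨e1⟩ := s4Kernels_isGroupTrisection_holds.triple
    haveI : Subsingleton s4Kernels.tripleQuotient := e1.toEquiv.subsingleton
    refine ⟨(QuotientGroup.quotientMulEquivOfEq ?_).trans (e.trans (coprodEquivOfSubsingleton eG))⟩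
    simp only [TrisectionKernels.stabilize_apply]
    rw [normalClosure_iUnion_normalClosure, stabSet_iUnion]

end Literature.Topology.FourManifolds

end
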